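import Literature.MathematicalPhysics.QuantumFieldTheory.Balaban1983to89.B9Thm313WholeLeft
import Literature.MathematicalPhysics.QuantumFieldTheory.Balaban1983to89.B9Thm313WholeZ

/-!
# `Balaban1983to89.B9Thm313WholeLeftZ` — [B9] Theorem 3.13 (p. 426), II-Z: the LEFT sup entry (3.42)₂ of 𝔊 (∇_U𝔊) AT ONE MEMBER with the
# coarse-field letters RE-CLASSED through a free weighted middle class (sequel of `B9Thm313WholeZ`; R1-cls of the cell's located
# «C-LETTER-FLAT-AT-ONE»)

T. Bałaban, *Propagators for lattice gauge theories in a background field*, Commun. Math. Phys. **99** (1985) 389–434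
[`Balaban1985BackgroundPropagators`, "B9"]; [4] = T. Bałaban, *Propagators and renormalization transformations for lattice
gauge theories. II*, Commun. Math. Phys. **96** (1984) 223–250 [`Balaban1984PropagatorsII`].  statement-level skeleton of published
theorems with citation tags; proofs where landed; nothing here is a claim about the Yang–Mills mass gap.

THE POINT.  `B9Thm313WholeLeft.GG_entry1_of_letters` reduces ∇_U𝔊's sup entry (3.42)₂ to the letters `Letters313` + `Letters313D`; two of
those letters — `Letters313.gQs2` (G₀Q\* OUT OF the coarse class) and `Letters313D.dgQs` (∇_UG₀Q\* out of it), composed with `Letters313.c1_2`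
((QG₁Q\*)⁻¹ INTO it) — meet in the FLAT coarse class `cNorm blkZ 0`, which the cell located as unsatisfiable at the knit's flat pins (n06-h
«C-LETTER-FLAT-AT-ONE»: (QGQ\*)⁻¹ alone carries L^{+jD}; only the product H = G₀Q\*C is convention-free).  `B9Thm313WholeZ.Letters313Z` re-classes
that middle norm to `weightNorm (ofBlocks blkZ) wZ` with a FREE positive weight; this file does the same for the ∇-letter:
* §1 `Letters313DZ 𝔬 R₀ H₀ hG wZ hwZ B₃ δ₃ bH U` — `Letters313D` with `dgQs` sourced at `weightNorm (ofBlocks blkZ) wZ` (`rgdH`, `dgDH` unchanged);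
* §2 ★ `GG_entry1_of_lettersZ` — the statement of `GG_entry1_of_letters` over `Letters313Z` ∕ `Letters313DZ`, SAME constant `constD313 …`, same
  rates; proof verbatim (`hasMaj_right_of_step_weight`, cutting cost 1 by `weightNorm_ofBlocks_κ`).
`wZ ≡ 1` recovers the old schema definitionally (`cNorm … 0 = weightNorm (ofBlocks …) (wt g 0)`).

HONEST SCOPE.  Nothing of print is asserted: the letters are HYPOTHESES of printed ∕ md shape; the content is the algebra of (3.153) differentiated
on the left and its block-majorant bookkeeping, now with one free weight.  NOT a node discharge, NOT summit progress; one finite lattice at a time;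
nothing continuum, nothing about the mass gap.  Cell `pub-ymgap` (HUMAN RULING D-0062), Track A node N06 [B9], N06-ASSIGNMENT v1 row 21 (bundle F7),
seat `pub-ymgap-dag-n06-l` (g14), 2026-08-27.  NEW file; `B9Thm313WholeLeft` is imported BY NAME and not modified.
-/

namespace Literature.MathematicalPhysics.QuantumFieldTheory.Balaban1983to89.B9Thm313WholeLeftZ

open Literature.MathematicalPhysics.QuantumFieldTheory.Balaban1983to89
open Finset B6RandomWalk B6RandomWalkHom B9Thm34Ext B9Thm37GlueCor36 B11SectG B9SectDSup
open B9Thm37AllNorms B9Thm37AllNormsInstances B9FromB6 B9FromB6ModelSignsOn B9Thm312Whole B9Thm312WholeLeaf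
open B9Thm312WholeLeft B9Thm313Whole B9Thm313WholeLeft B9Thm313WholeZ

noncomputable section

section OneMember

variable {g : B9.Geometry} {B : B9.Backgrounds} {X Y Z W : Type}
variable [Fintype X] [Fintype Y] [Fintype Z] [Fintype W] [Fintype g.Site]

/-! ## §1 The ∇-letters of the left entry of 𝔊 with the coarse class re-weighted (printed ∕ md shape; nothing asserted) -/

/-- **THE LETTERS OF ∇_U𝔊's REDUCTION AT U, COARSE CLASS RE-WEIGHTED** (`Letters313D` with `dgQs` sourced at `weightNorm (ofBlocks blkZ) wZ`, the
class in which `Letters313Z.gQs2` leaves and `Letters313Z.c1_2` arrives): `dgQs` = ∇_UG₀Q\* out of the weighted coarse class into 𝔠_Y⁽¹⁾, B₃e^{−δ₃d};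
`rgdH` = RD\*G₁ into the free Hölder class `bH`; `dgDH` = ∇_UG₀D out of `bH` — hypotheses of printed ∕ md shape, nothing asserted.
[cite: Balaban1985BackgroundPropagators, Thm 3.13 p.426 + (3.152)–(3.153) p.426 + (3.42)–(3.44) pp.397–398 + (3.49) p.399] -/
structure Letters313DZ (𝔬 : Ops g B X Y Z W) (R₀ : ℝ) (H₀ : Prop) (hG : GeoOK g) (wZ : g.Site → ℝ) (hwZ : ∀ y, 0 < wZ y) (B₃ δ₃ : ℝ)
    (bH : BlockNorm (toB6 g R₀ H₀) (W → ℝ)) (U : B.Cfg) : Prop where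
  dgQs : HasMaj (weightNorm (BlockNorm.ofBlocks (toB6 g R₀ H₀) 𝔬.blkZ) wZ fun y => (hwZ y).le) (cNorm R₀ H₀ 𝔬.blkY hG.lenle 1)
    (𝔬.D U ∘ₗ 𝔬.G0 U ∘ₗ 𝔬.Qstar U) (fun a b => B₃ * Real.exp (-(δ₃ * g.dist a b)))
  rgdH : HasMaj (cNorm R₀ H₀ 𝔬.blk hG.lenle 0) bH (𝔬.R U ∘ₗ 𝔬.Dvstar U ∘ₗ 𝔬.G1 U ∘ₗ LinearMap.id)
    (fun a b => B₃ * Real.exp (-(δ₃ * g.dist a b)))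
  dgDH : HasMaj bH (cNorm R₀ H₀ 𝔬.blkY hG.lenle 1) (𝔬.D U ∘ₗ 𝔬.G0 U ∘ₗ 𝔬.Dv U)
    (fun a b => B₃ * Real.exp (-(δ₃ * g.dist a b)))

/-! ## §2 One member, one U: the left sup entry (3.42)₂ of 𝔊 over the re-classed letters -/

/-- ★ **THEOREM 3.13, ENTRY (3.42)₂ FOR 𝔊, PRINTED SHAPE, COARSE LETTERS THROUGH THE WEIGHTED CLASS Z_{wZ}** (statement of
`B9Thm313WholeLeft.GG_entry1_of_letters` over `Letters313Z` ∕ `Letters313DZ`; proof VERBATIM but for `hasMaj_right_of_step_weight` at `gQs2` and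
the cutting cost `weightNorm_ofBlocks_κ = 1` of the weighted middle class) — the reduction at U for ∇_U𝔊: from Theorem 3.3's (3.42)₁ (`he0`) and (3.42)₂
(`hLS.e1`) for G₀, the step K′₁ = G₀(Δ′_π + Δ⁽²⁾_π) on 𝔠⁽²⁾ (θe^{−δ_K d}, θc < 1) and its derivative (`hLS.stepD1`, θ′e^{−δ_K d}), the
resolvent identity of (3.138), the letters `gD2`, `gQs2`, `rgd2`, `c1_2`, `q2` of `Letters313Z`, the letters `dgQs`, `rgdH`, `dgDH` of
`Letters313DZ` through the Hölder class `bH` (cutting cost κ_H), and (3.153): |(∇_U𝔊λ)(x)| ≦ C·L^jη·e^{−ρ′d(y,y′)}|λ| for x ∈ Δ(y), supp λ ⊂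
Δ(y′), C = `constD313 (B₀ + θ′·B₀(1−θc)⁻¹·c) θ′ (B₀(1−θc)⁻¹) (B₃(1−θc)⁻¹) B₃ κ_H c`, for every ρ′ ≧ 0 with ρ′ + 3σ ≦ ρ (ρ ≦ δ₀, ρ ≦ δ₃, ρ + σ
≦ δ_K).  Route: `D_GG_eq`; ∇_UG₁, ∇_UG₁D, ∇_UG₁Q* by `hasMaj_left_right`; eight compositions ([4] (2.54) + (2.61)).
[cite: Balaban1985BackgroundPropagators, Thm 3.13 p.426 + (3.152)–(3.153) p.426 + (3.138) p.423 + (3.42)–(3.44) pp.397–398] -/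
theorem GG_entry1_of_lettersZ {R₀ : ℝ} {H₀ : Prop} (hG : GeoOK g) {𝔬 : Ops g B X Y Z W} {U : B.Cfg}
    {bH : BlockNorm (toB6 g R₀ H₀) (W → ℝ)}
    {θ θ' B₀ B₃ δ₀ δ₃ δK ρ ρ' σ c : ℝ} (hrow : RowSum (toB6 g R₀ H₀) σ c) (hc : 0 ≤ c)
    (hθ : 0 ≤ θ) (hθ' : 0 ≤ θ') (hB₀ : 0 ≤ B₀) (hB₃ : 0 ≤ B₃) (hσ : 0 ≤ σ) (hρ' : 0 ≤ ρ') (hρ'ρ : ρ' + 3 * σ ≤ ρ) (hρS : ρ ≤ δ₀)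
    (hρ₃ : ρ ≤ δ₃) (hρδ : ρ + σ ≤ δK) (hq : θ * c < 1)
    (hK : HasMaj (cNorm R₀ H₀ 𝔬.blk hG.lenle 2) (cNorm R₀ H₀ 𝔬.blk hG.lenle 2) (𝔬.G0 U ∘ₗ (𝔬.Tpi U + 𝔬.T2 U))
      (fun a b => θ * Real.exp (-(δK * g.dist a b))))
    (he0 : HasMajorant (g := toB6 g R₀ H₀) 𝔬.blk (𝔬.G0 U) (fun a b => B₀ * g.len a ^ 2 * Real.exp (-(δ₀ * g.dist a b))))
    (hLS : LeftStep 𝔬 R₀ H₀ hG.lenle B₀ δ₀ θ' δK U)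
    {wZ : g.Site → ℝ} {hwZ : ∀ y, 0 < wZ y}
    (hL : Letters313Z 𝔬 R₀ H₀ hG wZ hwZ B₃ δ₃ U) (hLD : Letters313DZ 𝔬 R₀ H₀ hG wZ hwZ B₃ δ₃ bH U) (hI : Identities 𝔬 U) :
    HasMajorantHom (g := toB6 g R₀ H₀) 𝔬.blk 𝔬.blkY (𝔬.D U ∘ₗ 𝔬.GG U)
      (fun a b => constD313 (B₀ + θ' * (B₀ * (1 - θ * c)⁻¹) * c) θ' (B₀ * (1 - θ * c)⁻¹) (B₃ * (1 - θ * c)⁻¹) B₃ bH.κ c *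
        g.len a * Real.exp (-(ρ' * g.dist a b))) := by
  have hq1 : 0 ≤ (1 - θ * c)⁻¹ := inv_nonneg.mpr (by linarith)
  have hA₁ : 0 ≤ B₀ * (1 - θ * c)⁻¹ := mul_nonneg hB₀ hq1
  have hA₃ : 0 ≤ B₃ * (1 - θ * c)⁻¹ := mul_nonneg hB₃ hq1
  have hCL : 0 ≤ B₀ + θ' * (B₀ * (1 - θ * c)⁻¹) * c := add_nonneg hB₀ (mul_nonneg (mul_nonneg hθ' hA₁) hc)
  have hfix1 := fix_of_inverses hI.invG0' hI.invG1
  have hρ0 : 0 ≤ ρ := by linarith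
  have htri : Triangle254 (toB6 g R₀ H₀) := fun a b c => hG.tri a b c
  -- (a) the right entries of G₁: G₁ : 𝔠⁽⁰⁾ → 𝔠⁽²⁾, G₁D : W¹ → 𝔠⁽²⁾, G₁Q* : Z⁰ → 𝔠⁽²⁾ (as in `GG_entry0_of_letters`)
  have hG1 : HasMaj (cNorm R₀ H₀ 𝔬.blk hG.lenle 0) (cNorm R₀ H₀ 𝔬.blk hG.lenle 2) (𝔬.G1 U ∘ₗ LinearMap.id)
      (fun a b => B₀ * (1 - θ * c)⁻¹ * Real.exp (-(ρ * g.dist a b))) := by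
    rw [LinearMap.comp_id]
    exact hasMaj_entry0_cNorm hG hrow hθ hB₀ hρ0 hρS hρδ hK he0 hfix1 hq
  have hGD := hasMaj_right_of_step hG hrow hθ hB₃ hρ0 hρ₃ hρδ hK hL.gD2 hfix1 hq
  have hGQ := hasMaj_right_of_step_weight hG hwZ hrow hθ hB₃ hρ0 hρ₃ hρδ hK hL.gQs2 hfix1 hq
  -- (b) the left-and-right entries ∇G₁ : 𝔠⁽⁰⁾ → 𝔠_Y⁽¹⁾, ∇G₁D : W¹ → 𝔠_Y⁽¹⁾, ∇G₁Q* : Z⁰ → 𝔠_Y⁽¹⁾, all at the rate ρ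
  have h10 : HasMaj (BlockNorm.ofBlocks (toB6 g R₀ H₀) 𝔬.blk) (BlockNorm.ofBlocks (toB6 g R₀ H₀) 𝔬.blkY) (𝔬.D U ∘ₗ 𝔬.G0 U)
      (fun a b => B₀ * g.len a * Real.exp (-(δ₀ * g.dist a b))) :=
    hasMaj_of_hasMajorantHom (G := toB6 g R₀ H₀) 𝔬.blk 𝔬.blkY
      (fun a b => mul_nonneg (mul_nonneg hB₀ (hG.lenle a)) (Real.exp_nonneg _)) hLS.e1
  have hE0 : HasMaj (cNorm R₀ H₀ 𝔬.blk hG.lenle 0) (cNorm R₀ H₀ 𝔬.blkY hG.lenle 1) (𝔬.D U ∘ₗ 𝔬.G0 U ∘ₗ LinearMap.id)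
      (fun a b => B₀ * Real.exp (-(δ₀ * g.dist a b))) := by
    rw [LinearMap.comp_id]
    refine (hasMaj_cNorm_of_hasMaj hG 1 0 h10).mono fun y y' => le_of_eq ?_
    have hy : g.len y ≠ 0 := (hG.lenpos y).ne'
    simp only [wt, pow_zero, pow_one, mul_one]
    rw [mul_assoc B₀, mul_comm (g.len y), ← mul_assoc B₀, mul_assoc, mul_inv_cancel₀ hy, mul_one]
  have hD1 : HasMaj (cNorm R₀ H₀ 𝔬.blk hG.lenle 0) (cNorm R₀ H₀ 𝔬.blkY hG.lenle 1) (𝔬.D U ∘ₗ 𝔬.G1 U ∘ₗ LinearMap.id)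
      (fun y y' => (B₀ + θ' * (B₀ * (1 - θ * c)⁻¹) * c) * Real.exp (-(ρ * g.dist y y'))) :=
    hasMaj_left_right hG hrow hθ' hB₀ hA₁ hρ0 hρS le_rfl hρδ hLS.stepD1 hE0 hG1 hfix1
  -- (c) TERM B = (∇G₁D)(RD*G₁) = (∇G₀D)(RD*G₁) + ((∇G₀T₁)(G₁D))(RD*G₁): the first summand through the Hölder class `bH`, the
  --     second through the sup class W¹ (letter `rgd2`)
  have hρ'₃ : ρ' ≤ δ₃ := by linarith
  have hρ'σ₃ : ρ' + σ ≤ δ₃ := by linarith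
  have hB1 : HasMaj (cNorm R₀ H₀ 𝔬.blk hG.lenle 0) (cNorm R₀ H₀ 𝔬.blkY hG.lenle 1)
      ((𝔬.D U ∘ₗ 𝔬.G0 U ∘ₗ 𝔬.Dv U) ∘ₗ (𝔬.R U ∘ₗ 𝔬.Dvstar U ∘ₗ 𝔬.G1 U ∘ₗ LinearMap.id))
      (fun y y' => bH.κ * B₃ * B₃ * c * Real.exp (-(ρ' * g.dist y y'))) :=
    hasMaj_comp_exp htri hG.dnn hrow hB₃ hB₃ hρ' hρ'₃ hρ'σ₃ hLD.dgDH hLD.rgdH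
  have hGDT : HasMaj (cNorm R₀ H₀ 𝔬.blkW hG.lenle 1) (cNorm R₀ H₀ 𝔬.blkY hG.lenle 1)
      ((𝔬.D U ∘ₗ 𝔬.G0 U ∘ₗ (𝔬.Tpi U + 𝔬.T2 U)) ∘ₗ (𝔬.G1 U ∘ₗ 𝔬.Dv U))
      (fun y y' => (cNorm R₀ H₀ 𝔬.blk hG.lenle 2 (X := X)).κ * θ' * (B₃ * (1 - θ * c)⁻¹) * c *
        Real.exp (-((ρ' + σ) * g.dist y y'))) :=
    hasMaj_comp_exp htri hG.dnn hrow hθ' hA₃ (by linarith) (by linarith) (by linarith) hLS.stepD1 hGD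
  simp only [cNorm_κ, one_mul] at hGDT
  have hθA₃ : 0 ≤ θ' * (B₃ * (1 - θ * c)⁻¹) * c := mul_nonneg (mul_nonneg hθ' hA₃) hc
  have hB2 : HasMaj (cNorm R₀ H₀ 𝔬.blk hG.lenle 0) (cNorm R₀ H₀ 𝔬.blkY hG.lenle 1)
      (((𝔬.D U ∘ₗ 𝔬.G0 U ∘ₗ (𝔬.Tpi U + 𝔬.T2 U)) ∘ₗ (𝔬.G1 U ∘ₗ 𝔬.Dv U)) ∘ₗ
        (𝔬.R U ∘ₗ 𝔬.Dvstar U ∘ₗ 𝔬.G1 U ∘ₗ LinearMap.id))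
      (fun y y' => (cNorm R₀ H₀ 𝔬.blkW hG.lenle 1 (X := W)).κ * (θ' * (B₃ * (1 - θ * c)⁻¹) * c) * B₃ * c *
        Real.exp (-(ρ' * g.dist y y'))) :=
    hasMaj_comp_exp htri hG.dnn hrow hθA₃ hB₃ hρ' hρ'₃ le_rfl hGDT hL.rgd2
  simp only [cNorm_κ, one_mul] at hB2
  have eB : (𝔬.D U ∘ₗ 𝔬.G1 U ∘ₗ 𝔬.Dv U) ∘ₗ (𝔬.R U ∘ₗ 𝔬.Dvstar U ∘ₗ 𝔬.G1 U ∘ₗ LinearMap.id) =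
      (𝔬.D U ∘ₗ 𝔬.G0 U ∘ₗ 𝔬.Dv U) ∘ₗ (𝔬.R U ∘ₗ 𝔬.Dvstar U ∘ₗ 𝔬.G1 U ∘ₗ LinearMap.id) +
        (((𝔬.D U ∘ₗ 𝔬.G0 U ∘ₗ (𝔬.Tpi U + 𝔬.T2 U)) ∘ₗ (𝔬.G1 U ∘ₗ 𝔬.Dv U)) ∘ₗ
          (𝔬.R U ∘ₗ 𝔬.Dvstar U ∘ₗ 𝔬.G1 U ∘ₗ LinearMap.id)) := by
    rw [comp_fix_left_right (𝔬.D U) (𝔬.Dv U) hfix1, LinearMap.add_comp]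
  have hB := hB1.add hB2
  rw [← eB] at hB
  -- (d) TERM C = (∇G₁Q*)((QG₁Q*)⁻¹QG₁) through the sup classes Z², Z⁰
  have hQG : HasMaj (cNorm R₀ H₀ 𝔬.blk hG.lenle 0) (cNorm R₀ H₀ 𝔬.blkZ hG.lenle 2) (𝔬.Q U ∘ₗ (𝔬.G1 U ∘ₗ LinearMap.id))
      (fun a b => (cNorm R₀ H₀ 𝔬.blk hG.lenle 2 (X := X)).κ * B₃ * (B₀ * (1 - θ * c)⁻¹) * c *
        Real.exp (-((ρ' + 2 * σ) * g.dist a b))) :=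
    hasMaj_comp_exp htri hG.dnn hrow hB₃ hA₁ (by linarith) (by linarith) (by linarith) hL.q2 hG1
  simp only [cNorm_κ, one_mul] at hQG
  have hK₁ : 0 ≤ B₃ * (B₀ * (1 - θ * c)⁻¹) * c := mul_nonneg (mul_nonneg hB₃ hA₁) hc
  have hCQG : HasMaj (cNorm R₀ H₀ 𝔬.blk hG.lenle 0) (weightNorm (BlockNorm.ofBlocks (toB6 g R₀ H₀) 𝔬.blkZ) wZ fun y => (hwZ y).le)
      (𝔬.C1 U ∘ₗ (𝔬.Q U ∘ₗ (𝔬.G1 U ∘ₗ LinearMap.id)))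
      (fun a b => (cNorm R₀ H₀ 𝔬.blkZ hG.lenle 2 (X := Z)).κ * B₃ * (B₃ * (B₀ * (1 - θ * c)⁻¹) * c) * c *
        Real.exp (-((ρ' + σ) * g.dist a b))) :=
    hasMaj_comp_exp htri hG.dnn hrow hB₃ hK₁ (by linarith) (by linarith) (by linarith) hL.c1_2 hQG
  simp only [cNorm_κ, one_mul] at hCQG
  have hD1Q : HasMaj (weightNorm (BlockNorm.ofBlocks (toB6 g R₀ H₀) 𝔬.blkZ) wZ fun y => (hwZ y).le)
      (cNorm R₀ H₀ 𝔬.blkY hG.lenle 1) (𝔬.D U ∘ₗ 𝔬.G1 U ∘ₗ 𝔬.Qstar U)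
      (fun y y' => (B₃ + θ' * (B₃ * (1 - θ * c)⁻¹) * c) * Real.exp (-((ρ' + σ) * g.dist y y'))) :=
    hasMaj_left_right hG hrow hθ' hB₃ hA₃ (by linarith) (by linarith) (by linarith) (by linarith) hLS.stepD1 hLD.dgQs hGQ
      hfix1
  have hBθ : 0 ≤ B₃ + θ' * (B₃ * (1 - θ * c)⁻¹) * c := add_nonneg hB₃ hθA₃
  have hK₂ : 0 ≤ B₃ * (B₃ * (B₀ * (1 - θ * c)⁻¹) * c) * c := mul_nonneg (mul_nonneg hB₃ hK₁) hc
  have hC : HasMaj (cNorm R₀ H₀ 𝔬.blk hG.lenle 0) (cNorm R₀ H₀ 𝔬.blkY hG.lenle 1)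
      ((𝔬.D U ∘ₗ 𝔬.G1 U ∘ₗ 𝔬.Qstar U) ∘ₗ (𝔬.C1 U ∘ₗ (𝔬.Q U ∘ₗ (𝔬.G1 U ∘ₗ LinearMap.id))))
      (fun y y' => (weightNorm (BlockNorm.ofBlocks (toB6 g R₀ H₀) 𝔬.blkZ) wZ fun y => (hwZ y).le).κ *
        (B₃ + θ' * (B₃ * (1 - θ * c)⁻¹) * c) *
        (B₃ * (B₃ * (B₀ * (1 - θ * c)⁻¹) * c) * c) * c * Real.exp (-(ρ' * g.dist y y'))) :=
    hasMaj_comp_exp htri hG.dnn hrow hBθ hK₂ hρ' (by linarith) le_rfl hD1Q hCQG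
  simp only [weightNorm_ofBlocks_κ, one_mul] at hC
  -- (e) assembling (3.153) differentiated on the left
  have h := ((hD1.of_rate_le hG.dnn hCL (by linarith : ρ' ≤ ρ)).sub hB).sub hC
  rw [← D_GG_eq hI] at h
  have hC0 : 0 ≤ constD313 (B₀ + θ' * (B₀ * (1 - θ * c)⁻¹) * c) θ' (B₀ * (1 - θ * c)⁻¹) (B₃ * (1 - θ * c)⁻¹) B₃ bH.κ c :=
    constD313_nonneg hCL hθ' hA₁ hA₃ hB₃ bH.κ_nonneg hc
  have h2 : HasMaj (cNorm R₀ H₀ 𝔬.blk hG.lenle 0) (cNorm R₀ H₀ 𝔬.blkY hG.lenle 1) (𝔬.D U ∘ₗ 𝔬.GG U)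
      (fun a b => constD313 (B₀ + θ' * (B₀ * (1 - θ * c)⁻¹) * c) θ' (B₀ * (1 - θ * c)⁻¹) (B₃ * (1 - θ * c)⁻¹) B₃ bH.κ c *
        Real.exp (-(ρ' * g.dist a b))) :=
    h.mono fun a b => le_of_eq (by simp only [constD313, toB6_dist]; ring)
  have h' := hasMajorantHom_of_hasMaj_cNorm hG (fun a b => mul_nonneg hC0 (Real.exp_nonneg _)) h2
  refine hasMajorantHom_mono (g := toB6 g R₀ H₀) 𝔬.blk 𝔬.blkY h' fun a b => le_of_eq ?_
  simp only [wt, pow_zero, pow_one, inv_one, mul_one]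
  ring

end OneMember

end

end Literature.MathematicalPhysics.QuantumFieldTheory.Balaban1983to89.B9Thm313WholeLeftZ
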